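import Mathlib
import HarnessLib
import Summits.NavierStokesRegularity.NavierStokesRegularity.Theorems.LocalSineTubeDoorSequentialDoor
import Summits.NavierStokesRegularity.NavierStokesRegularity.Theorems.LocalSineTubeDoorProfileAlignedWindowRigidity
import Summits.NavierStokesRegularity.NavierStokesRegularity.Theorems.PoloidalWindowDoorPoloidalWindowRigidityFlat

/-!
# An UNCONDITIONAL instance of the sequential door: the fixed-direction sine door along bounded-gap times

Cell ns-regularity-ideate, seat p6 (`--supports stmt-NavierStokesRegularity-20017`; rung N0-LocalTubeDoorSine neighbourhood).
The sequential door template `…SequentialDoor.sequentialDoor_of_oneSliceWindowRigidity` instantiated with the first-order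
scalar `F(x, A) = ‖(curlCLM A) × e‖` (the `e`-orthogonal part of the vorticity) and the ONE-SLICE profile crux of the closed
route LocalSineTubeDoor (`…ProfileAlignedWindowRigidity.eq_zero_of_aligned_window`, item stmt-…-20018: vorticity parallel to
a fixed `e ≠ 0` on ONE slice's nonempty open window forces `v ≡ 0`):

* `sequentialFixedDirectionDoor` — **regularity criterion (unconditional):** let `u` be a classical Leray–Hopf solution on
  `[0,T)` from rapidly decaying data, LOCALLY Type I at `(x₀,T)`, `e ≠ 0`, `U` a nonempty open window, and `tₖ → T` a
  sequence of times in `[0,T)` with bounded gaps (`T − tₖ₊₁ ≥ c (T − tₖ)`, `c > 0`) along which the `e`-orthogonal part of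
  the scale-normalised vorticity fades in `L¹` over the window:
  `∫_U ‖(T − tₖ) curl u(tₖ, x₀ + √(T−tₖ) y) × e‖ dy → 0`.  Then `u` stays bounded near `x₀` up to time `T`.
  Compared with the all-times fixed-direction door this only asks for fading along ONE bounded-gap sequence of times.

WHAT THIS IS NOT: not a claim about Navier–Stokes regularity (Clay A) — a local, conditional-on-Type-I regularity CRITERION;
its establishment in the cell's sense needs the cross-family referee PASS + independent reproduction (bears_on LADDER-NS N0).
-/

noncomputable section

-- the summit and its single sub-problem share the name (CONVENTIONS §1), as in every Theorems file
set_option linter.dupNamespace false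

namespace Summit.NavierStokesRegularity.NavierStokesRegularity.Theorems.LocalSineTubeDoorSequentialFixedDirectionDoor

open MeasureTheory Set Function Filter Topology TopologicalSpace Metric
open scoped RealInnerProductSpace InnerProductSpace NNReal ENNReal
open Literature.Analysis Literature.Analysis.FluidPDE
open Summit.NavierStokesRegularity.NavierStokesRegularity.Theorems.LocalSineTubeDoorProfileAlignedWindowRigidity
open Summit.NavierStokesRegularity.NavierStokesRegularity.Theorems.PoloidalWindowDoorPoloidalWindowRigidityFlat
open Summit.NavierStokesRegularity.NavierStokesRegularity.Theorems.LocalSineTubeDoorSequentialDoor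

/-- The sine-door scalar `F(x, A) = ‖(curlCLM A) × e‖` is continuous in `(x, A)`. -/
theorem continuous_crossCurlNorm (e : EuclideanSpace ℝ (Fin 3)) :
    Continuous fun q : EuclideanSpace ℝ (Fin 3) × (EuclideanSpace ℝ (Fin 3) →L[ℝ] EuclideanSpace ℝ (Fin 3)) =>
      ‖cross (curlCLM q.2) e‖ := by
  have h : Continuous fun q : EuclideanSpace ℝ (Fin 3) × (EuclideanSpace ℝ (Fin 3) →L[ℝ] EuclideanSpace ℝ (Fin 3)) =>
      (crossCLM.flip e) (curlCLM q.2) :=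
    (crossCLM.flip e).continuous.comp (curlCLM.continuous.comp continuous_snd)
  refine (continuous_norm.comp h).congr fun q => ?_
  simp only [Function.comp_apply, ContinuousLinearMap.flip_apply, crossCLM_apply]

/-- The zero set of `F(x, A) = ‖(curlCLM A) × e‖` is invariant under positive rescalings of both arguments. -/
theorem crossCurlNorm_zeroSet_invariant (e : EuclideanSpace ℝ (Fin 3)) :
    ∀ (a b : ℝ), 0 < a → 0 < b → ∀ (x : EuclideanSpace ℝ (Fin 3))
      (A : EuclideanSpace ℝ (Fin 3) →L[ℝ] EuclideanSpace ℝ (Fin 3)),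
      ‖cross (curlCLM (b • A)) e‖ = 0 ↔ ‖cross (curlCLM A) e‖ = 0 := by
  intro a b _ hb x A
  have h : cross (curlCLM (b • A)) e = b • cross (curlCLM A) e := by
    rw [map_smul, ← crossCLM_apply, ← crossCLM_apply, map_smul, smul_apply]
  rw [h, norm_smul, mul_eq_zero, Real.norm_eq_abs, abs_eq_zero, or_iff_right hb.ne']

/-- **THE SEQUENTIAL FIXED-DIRECTION SINE DOOR (unconditional).**  See the module docstring. -/
theorem sequentialFixedDirectionDoor :
    ∀ (ν T : ℝ), 0 < ν → 0 < T → ∀ (u : ℝ → EuclideanSpace ℝ (Fin 3) → EuclideanSpace ℝ (Fin 3))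
      (p : ℝ → EuclideanSpace ℝ (Fin 3) → ℝ),
    Literature.Analysis.FluidPDE.IsClassicalNSSolutionOn (Set.Ico 0 T) ν 0 u p →
    Literature.Analysis.FluidPDE.IsLerayHopfOn T ν 0 (u 0) u →
    Literature.Analysis.FluidPDE.HasRapidSpatialDecay (u 0) →
    ∀ (x₀ : EuclideanSpace ℝ (Fin 3)) (ρ M : ℝ), 0 < ρ →
    (∀ t ∈ Set.Ico 0 T, T - ρ ^ 2 < t → ∀ x ∈ Metric.ball x₀ ρ, ‖u t x‖ * Real.sqrt (ν * (T - t)) ≤ M) →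
    ∀ (e : EuclideanSpace ℝ (Fin 3)), e ≠ 0 →
    ∀ (U : Set (EuclideanSpace ℝ (Fin 3))), IsOpen U → U.Nonempty →
    ∀ (t : ℕ → ℝ) (c : ℝ), 0 < c → (∀ k, t k ∈ Set.Ico 0 T) → Filter.Tendsto t Filter.atTop (nhds T) →
    (∀ k, c * (T - t k) ≤ T - t (k + 1)) →
    Filter.Tendsto (fun k => ∫⁻ y in U, ENNReal.ofReal
      ‖Literature.Analysis.FluidPDE.cross ((T - t k) • Literature.Analysis.FluidPDE.curl (u (t k))
        (x₀ + Real.sqrt (T - t k) • y)) e‖) Filter.atTop (nhds 0) →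
    Literature.Analysis.FluidPDE.IsBackwardBoundedAt u T x₀ := by
  intro ν T hν hT u p hsol hLH hdec x₀ ρ M hρ hM e he U hU hUne t c hc htk htT hgap hfade
  -- the one-slice profile crux for the sine scalar: `eq_zero_of_aligned_window`
  have hcrux : ∀ (C : ℝ) (v : ℝ → EuclideanSpace ℝ (Fin 3) → EuclideanSpace ℝ (Fin 3)),
      Literature.Analysis.FluidPDE.HasTypeITimeDecay C v →
      ContinuousOn (Function.uncurry v) (Set.Iio (0 : ℝ) ×ˢ Set.univ) →
      (∀ s t : ℝ, s < t → t < 0 → ∀ x, v t x =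
        Literature.Analysis.UnboundedOperators.heatExtension (v s) (t - s) x -
          Literature.Analysis.FluidPDE.oseenDuhamel 1 s v v t x) →
      (∀ t < 0, Literature.Analysis.FluidPDE.VectorCalculus.IsDivFree (v t)) →
      (∃ s < 0, ∃ U : Set (EuclideanSpace ℝ (Fin 3)), IsOpen U ∧ U.Nonempty ∧
        ∀ z ∈ U, (fun (x : EuclideanSpace ℝ (Fin 3)) (A : EuclideanSpace ℝ (Fin 3) →L[ℝ] EuclideanSpace ℝ (Fin 3)) =>
          ‖cross (curlCLM A) e‖) (v s z) (fderiv ℝ (v s) z) = 0) →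
      ¬ Literature.Analysis.FluidPDE.IsBackwardSingularPoint v 0 := by
    intro C v hrate hcont hmild hdiv hwin
    obtain ⟨s, hs, U', hU', hne', hal⟩ := hwin
    refine not_backwardSingular_of_zero (eq_zero_of_aligned_window hrate hcont hmild hdiv hs he hU' hne' ?_)
    intro z hz
    have h := hal z hz
    simp only [norm_eq_zero] at h
    rwa [← curl_eq_curlCLM] at h
  refine sequentialDoor_of_oneSliceWindowRigidity (fun x A => ‖cross (curlCLM A) e‖) (continuous_crossCurlNorm e)
    (crossCurlNorm_zeroSet_invariant e) hcrux ν T hν hT u p hsol hLH hdec x₀ ρ M hρ hM U hU hUne t c hc htk htT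
    hgap ?_
  -- the two window integrands agree: `‖curlCLM(√(T−t)² Du) × e‖ = ‖((T−t) curl u) × e‖` on `[0,T)`
  refine hfade.congr fun k => ?_
  refine lintegral_congr fun y => ?_
  have ht : 0 ≤ T - t k := (sub_pos.2 (htk k).2).le
  rw [map_smul, ← curl_eq_curlCLM, Real.sq_sqrt ht, abs_norm]

end Summit.NavierStokesRegularity.NavierStokesRegularity.Theorems.LocalSineTubeDoorSequentialFixedDirectionDoor

end
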